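import Summits.HodgeConjecture.HodgeConjecture.Theorems.PadicSemiregularLiftHodgeBeyondAnchorsReductions
import Summits.HodgeConjecture.HodgeConjecture.Theorems.PadicSemiregularLiftHodgeBeyondAnchorsProductDescent
import Summits.HodgeConjecture.HodgeConjecture.Theorems.PadicSemiregularLiftHodgeBeyondAnchorsProductsNotAnchors
import Literature.AlgebraicGeometry.HodgeTheory.ComplexConjugationHolds
import Literature.AlgebraicGeometry.HodgeTheory.HodgeFiltrationModelsReductionProofs
import Literature.AlgebraicGeometry.Motives.AbelianVarietyRationalCurvesProofs

/-!
# `HodgeBeyondAnchors ↔ HodgeConjecture`, unconditionally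

Route `PadicSemiregularLift` of `HodgeConjecture`, item `HodgeBeyondAnchors` (stmt-HodgeConjecture-14054,
the declared "remainder" crux: the Hodge conjecture for every smooth projective complex variety that is
neither `A.X` for an abelian variety `A` of that dimension nor a Fermat hypersurface).

The file `…HodgeBeyondAnchorsEquivalence` proved `HodgeBeyondAnchors → HodgeConjecture` GRANTED three named
facts of the tree, taken there as hypotheses (this file re-runs its product trick directly over the helper files
`…Reductions`, `…ProductDescent`, `…ProductsNotAnchors`, so as not to depend on that module): `nonempty_hodgeModel` (Hodge models of smooth projective
varieties exist), `hodgePQ_independent_of_hodgeModel` (Hodge types do not depend on the model) and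
`Milne1986_projectiveLine_to_abelianVariety_const` (abelian varieties contain no rational curves). All three
have since been DISCHARGED in `Literature/` (`nonempty_hodgeModel_holds`,
`hodgePQ_independent_of_hodgeModel_holds`, `Milne1986_projectiveLine_to_abelianVariety_const_holds`), so the
equivalence of the item with the summit is now a hypothesis-free theorem of the tree:

* `hodgeConjecture_of_class_stable_under_double_projectiveLine` — HC for the smooth projective members
  of ANY class `𝒞 ∋ (X × ℙ¹) × ℙ¹` (all smooth projective `X`, `dim X ≥ 1`) is already `HodgeConjecture`;
* `hodgeConjecture_of_hodgeBeyondAnchors_holds : HodgeBeyondAnchors → HodgeConjecture`;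
* `hodgeBeyondAnchors_iff_hodgeConjecture_holds : HodgeBeyondAnchors ↔ HodgeConjecture`;
* `anchors_of_hodgeBeyondAnchors_holds : HodgeBeyondAnchors → HodgeAbelianVarieties ∧ HodgeFermatVarieties`
  — the rank-6 remainder alone already carries the route's two output cruxes (ranks 4 and 5);
* `assembly_hypotheses_iff_hodgeBeyondAnchors` — the three hypotheses of the route's `Assembly`
  are jointly equivalent to the last of them.

Reading for the planner (numbers, not adjectives): as typed, item 14054 is kernel-checked EQUIVALENT to the
summit statement with no residual hypothesis; a complement-of-anchors restatement separates something only
if the excluded class is closed under `X ↦ X × ℙ¹ × ℙ¹` or the descent `HC(X × ℙ¹) ⇒ HC(X)` is blocked.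

References: J.S. Milne, *Abelian Varieties* (1986), §3 Cor. 3.8; C. Voisin, *Hodge Theory and Complex
Algebraic Geometry I* (2002), §7.3.2, §11.3; P. Deligne, *The Hodge conjecture* (2000), §1.
-/

-- Summit.HodgeConjecture.HodgeConjecture.… repeats the summit name by the D-0017 layout (Sub = Summit).
set_option linter.dupNamespace false

namespace Summit.HodgeConjecture.HodgeConjecture.Theorems.HodgeBeyondAnchors

open CategoryTheory AlgebraicGeometry MonoidalCategory
open Summit.HodgeConjecture.HodgeConjecture.Theses.PadicSemiregularLift
open Literature.AlgebraicTopology.SingularHomology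
open Literature.AlgebraicGeometry Literature.AlgebraicGeometry.HodgeTheory
  Literature.AlgebraicGeometry.Motives

/-- **Any "remainder" class that contains all double `ℙ¹`-products carries the whole Hodge
conjecture.** If a class `𝒞` of (dimension-indexed) complex varieties contains `(X × ℙ¹) × ℙ¹` for every
smooth projective `X` of dimension `n ≥ 1`, then the Hodge conjecture for the smooth projective members
of `𝒞` is already the Hodge conjecture: `HC((X × ℙ¹) × ℙ¹)` descends to `X` along the two projections
(`hodgeConjectureFor_of_tensor_tensor`, fed with the discharged facts `nonempty_hodgeModel_holds` and
`hodgePQ_independent_of_hodgeModel_holds`), and dimension `0` is the extreme-codimension case. This is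
the precise form of the planner-facing reading: a complement-form restatement of the remainder item
separates something only if the excluded class meets the double `ℙ¹`-products.
[cite: VoisinHodgeI2002, §7.3.2 and §11.3] [cite: Fulton1998, §10.1, Example 10.1.2] -/
theorem hodgeConjecture_of_class_stable_under_double_projectiveLine
    (𝒞 : ℕ → SchemeOver ℂ → Prop)
    (h𝒞 : ∀ (n : ℕ) (X : SchemeOver ℂ), IsSmoothProjective n X → 1 ≤ n →
      𝒞 (n + 1 + 1) ((X ⊗ projectiveSpace 1 ℂ) ⊗ projectiveSpace 1 ℂ))
    (h : ∀ ⦃n : ℕ⦄ ⦃X : SchemeOver ℂ⦄, IsSmoothProjective n X → 𝒞 n X → HodgeConjectureFor n X) :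
    _root_.HodgeConjecture := by
  intro n X hX
  rcases Nat.eq_zero_or_pos n with rfl | hn
  · exact ⟨nonempty_hodgeModel_holds hX, fun p c _ _ ↦ mem_algebraicClasses_of_extreme hX (by omega) c⟩
  have hL : IsSmoothProjective 1 (projectiveSpace 1 ℂ) := isSmoothProjective_projectiveSpace_holds ℂ 1
  haveI : Infinite (ComplexPoints (projectiveSpace 1 ℂ)) := infinite_complexPoints_projectiveSpace_one
  have hXL : IsSmoothProjective (n + 1) (X ⊗ projectiveSpace 1 ℂ) :=
    Motives.IsSmoothProjective.tensor_holds hX hL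
  have hXLL : IsSmoothProjective (n + 1 + 1) ((X ⊗ projectiveSpace 1 ℂ) ⊗ projectiveSpace 1 ℂ) :=
    Motives.IsSmoothProjective.tensor_holds hXL hL
  exact hodgeConjectureFor_of_tensor_tensor hodgePQ_independent_of_hodgeModel_holds hX hL
    (nonempty_hodgeModel_holds hX) (nonempty_hodgeModel_holds hXL) (h hXLL (h𝒞 n X hX hn))

/-- **`HodgeBeyondAnchors` implies the full Hodge conjecture, unconditionally**: the class of
non-anchors contains every `(X × ℙ¹) × ℙ¹` — not `A.X` for an abelian variety `A` (it contains rational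
curves; `abelianVariety_X_ne_tensor_tensor` fed with the discharged fact
`Milne1986_projectiveLine_to_abelianVariety_const_holds`) and not a Fermat hypersurface (`b₂ ≥ 2` against
Lefschetz, `not_isFermatVariety_tensor_tensor`) — so `hodgeConjecture_of_class_stable_under_double_projectiveLine`
applies.
[cite: Milne1986AbelianVarieties, §3 Cor. 3.8 (p. 107)] [cite: VoisinHodgeI2002, §7.3.2]
[cite: Deligne2000, §1] -/
theorem hodgeConjecture_of_hodgeBeyondAnchors_holds (h : HodgeBeyondAnchors) : _root_.HodgeConjecture := by
  -- a non-zero class in `H²(ℙ¹(ℂ); ℂ) ≅ ℂ`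
  obtain ⟨c, hc⟩ : ∃ c : complexBetti (projectiveSpace 1 ℂ) 2, c ≠ 0 := by
    have hfr : Module.finrank ℂ (complexBetti (projectiveSpace 1 ℂ) (2 * 1)) = 1 :=
      finrank_complexBetti_projectiveSpace_two_mul_eq_one 1 le_rfl
    obtain ⟨g, hg, -⟩ := finrank_eq_one_iff'.1 hfr
    exact ⟨g, hg⟩
  have hL : IsSmoothProjective 1 (projectiveSpace 1 ℂ) := isSmoothProjective_projectiveSpace_holds ℂ 1
  -- the non-anchor class contains every double `ℙ¹`-product
  refine hodgeConjecture_of_class_stable_under_double_projectiveLine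
    (fun n X ↦ (∀ A : AbelianVariety ℂ, A.dim = n → A.X ≠ X) ∧ (∀ m : ℕ, ¬ IsFermatVariety n m X))
    (fun n X hX hn ↦ ⟨fun A _ ↦
        abelianVariety_X_ne_tensor_tensor Milne1986_projectiveLine_to_abelianVariety_const_holds.{0} hX A,
      fun m ↦ not_isFermatVariety_tensor_tensor hX hn hL hc m⟩)
    fun n X hX hC ↦ h hX hC.1 hC.2

/-- **`HodgeBeyondAnchors ↔ HodgeConjecture`, unconditionally** (`←` is the restriction of the summit to
non-anchors). [cite: Deligne2000, §1] [cite: Milne1986AbelianVarieties, §3 Cor. 3.8 (p. 107)] -/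
theorem hodgeBeyondAnchors_iff_hodgeConjecture_holds :
    Summit.HodgeConjecture.HodgeConjecture.Theses.PadicSemiregularLift.HodgeBeyondAnchors ↔ HodgeConjecture :=
  ⟨hodgeConjecture_of_hodgeBeyondAnchors_holds, fun H _ _ hX _ _ ↦ H hX⟩

/-- **The remainder item implies the route's two output cruxes** `HodgeAbelianVarieties` (rank 4) and
`HodgeFermatVarieties` (rank 5), unconditionally. [cite: Deligne2000, §1] -/
theorem anchors_of_hodgeBeyondAnchors_holds (h : HodgeBeyondAnchors) :
    HodgeAbelianVarieties ∧ HodgeFermatVarieties :=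
  have H := hodgeConjecture_iff_anchors_and_beyond.1 (hodgeConjecture_of_hodgeBeyondAnchors_holds h)
  ⟨H.1, H.2.1⟩

/-- **The three hypotheses of the route's `Assembly` are jointly equivalent to the last one**: the typed
output layer `HodgeAbelianVarieties ∧ HodgeFermatVarieties ∧ HodgeBeyondAnchors` of route
`PadicSemiregularLift` collapses onto its rank-6 remainder. [cite: Deligne2000, §1] -/
theorem assembly_hypotheses_iff_hodgeBeyondAnchors :
    (HodgeAbelianVarieties ∧ HodgeFermatVarieties ∧ HodgeBeyondAnchors) ↔ HodgeBeyondAnchors :=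
  ⟨fun H ↦ H.2.2, fun h ↦
    ⟨(anchors_of_hodgeBeyondAnchors_holds h).1, (anchors_of_hodgeBeyondAnchors_holds h).2, h⟩⟩

end Summit.HodgeConjecture.HodgeConjecture.Theorems.HodgeBeyondAnchors
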